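import Mathlib

/-!
# The down-set matching lemma (complement matching of an order ideal of the Boolean lattice)

Support file for crux `stmt-CriticalPhenomena-4575` (master-family programme; the quadratic four-point row `Q44` of
`prim-bnk-1`, Conjecture W of gen 20), seat `prim-bnk-1` gen 21; memo
`run/shared/lean/prim/prim-l12/FROM-prim-bnk-1-gen21-CORE-KLEITMAN.md` §13.

**Lemma (`DownsetMatching.exists_matching`).**  Let `𝒟` be a down-set (order ideal) of subsets of a finite set `U`.
Then there is a map `ψ` which is injective on `𝒟` and sends every `S ∈ 𝒟` to a superset `ψ S ⊇ S` inside `U` whose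
complement `U \ ψ S` again lies in `𝒟`.  In other words the bipartite inclusion graph between `𝒟` and the family of
complements `{U \ D : D ∈ 𝒟}` (an up-set of the same cardinality) has a perfect matching along inclusions.

This is the transport step of the antipodal-count programme: with `𝒟` = the co-goods of a configuration (complements of
the good points, a down-set) every co-good `b` is matched to a good `ψ b ⊇ b`, hence every member whose reduced set is a
co-good is carried monotonically and injectively to a good (memo §11, §13; in the `G_ab ⊔ G_cy` family this is already a
perfect two-to-one transport and proves Conjecture W there).

Proof: induction on the ground set.  Splitting on an element `n`, `𝒟 = 𝒟₀ ⊔ (𝒟₁ + n)` with `𝒟₁ ⊆ 𝒟₀` down-sets on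
`U`; given matchings `ψ₀, ψ₁` for them, put `ψ (A + n) = ψ₀ A + n`, `ψ A = ψ₁ A` for `A ∈ 𝒟₁`, and `ψ A = ψ₀ A + n` for
`A ∈ 𝒟₀ \ 𝒟₁`.  Pure finite combinatorics; no named facts, no sorries, standard axioms.
-/

namespace Summit.CriticalPhenomena.PercolationContinuityZ3.Theorems

namespace DownsetMatching

open Finset

variable {α : Type*} [DecidableEq α]

/-- **Down-set matching lemma** (universe form).  For every finite `U` and every down-closed family `𝒟` of subsets of
`U` there is a map `ψ`, injective on `𝒟`, with `S ⊆ ψ S ⊆ U` and `U \ ψ S ∈ 𝒟` for all `S ∈ 𝒟`. [this work] -/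
theorem exists_matching_aux (U : Finset α) :
    ∀ 𝒟 : Finset (Finset α), (∀ S ∈ 𝒟, S ⊆ U) → (∀ S ∈ 𝒟, ∀ T, T ⊆ S → T ∈ 𝒟) →
      ∃ ψ : Finset α → Finset α, Set.InjOn ψ (𝒟 : Set (Finset α)) ∧ ∀ S ∈ 𝒟, S ⊆ ψ S ∧ ψ S ⊆ U ∧ U \ ψ S ∈ 𝒟 := by
  classical
  induction U using Finset.induction_on with
  | empty =>
    intro 𝒟 hU _
    refine ⟨fun S => S, ?_, ?_⟩
    · intro S _ T _ h; exact h
    · intro S hS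
      have hS0 : S = ∅ := Finset.subset_empty.1 (hU S hS)
      refine ⟨le_refl S, hU S hS, ?_⟩
      rw [hS0, Finset.sdiff_self]; rw [hS0] at hS; exact hS
  | @insert n U hn ih =>
    intro 𝒟 hU hdown
    -- the two slices
    set 𝒟₀ : Finset (Finset α) := 𝒟.filter (fun S => n ∉ S) with h𝒟₀
    set 𝒟₁ : Finset (Finset α) := 𝒟₀.filter (fun S => insert n S ∈ 𝒟) with h𝒟₁
    have h0mem : ∀ S, S ∈ 𝒟₀ ↔ S ∈ 𝒟 ∧ n ∉ S := by
      intro S; rw [h𝒟₀, Finset.mem_filter]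
    have h1mem : ∀ S, S ∈ 𝒟₁ ↔ (S ∈ 𝒟 ∧ n ∉ S) ∧ insert n S ∈ 𝒟 := by
      intro S; rw [h𝒟₁, Finset.mem_filter, h0mem]
    have hU0 : ∀ S ∈ 𝒟₀, S ⊆ U := by
      intro S hS
      obtain ⟨hSD, hnS⟩ := (h0mem S).1 hS
      intro x hx
      have hx' := hU S hSD hx
      rcases Finset.mem_insert.1 hx' with h | h
      · exact absurd (h ▸ hx) hnS
      · exact h
    have hdown0 : ∀ S ∈ 𝒟₀, ∀ T, T ⊆ S → T ∈ 𝒟₀ := by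
      intro S hS T hTS
      obtain ⟨hSD, hnS⟩ := (h0mem S).1 hS
      exact (h0mem T).2 ⟨hdown S hSD T hTS, fun h => hnS (hTS h)⟩
    have hU1 : ∀ S ∈ 𝒟₁, S ⊆ U := fun S hS => hU0 S (((h1mem S).1 hS).1 |> (h0mem S).2)
    have hdown1 : ∀ S ∈ 𝒟₁, ∀ T, T ⊆ S → T ∈ 𝒟₁ := by
      intro S hS T hTS
      obtain ⟨⟨hSD, hnS⟩, hSn⟩ := (h1mem S).1 hS
      refine (h1mem T).2 ⟨⟨hdown S hSD T hTS, fun h => hnS (hTS h)⟩, ?_⟩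
      exact hdown _ hSn _ (Finset.insert_subset_insert n hTS)
    obtain ⟨ψ₀, hinj₀, hψ₀⟩ := ih 𝒟₀ hU0 hdown0
    obtain ⟨ψ₁, hinj₁, hψ₁⟩ := ih 𝒟₁ hU1 hdown1
    -- the combined matching
    let ψ : Finset α → Finset α := fun S =>
      if n ∈ S then insert n (ψ₀ (S.erase n)) else if insert n S ∈ 𝒟 then ψ₁ S else insert n (ψ₀ S)
    have hψ_in : ∀ S, n ∈ S → ψ S = insert n (ψ₀ (S.erase n)) := by
      intro S h; simp only [ψ, if_pos h]
    have hψ_one : ∀ S, n ∉ S → insert n S ∈ 𝒟 → ψ S = ψ₁ S := by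
      intro S h h'; simp only [ψ, if_neg h, if_pos h']
    have hψ_zero : ∀ S, n ∉ S → insert n S ∉ 𝒟 → ψ S = insert n (ψ₀ S) := by
      intro S h h'; simp only [ψ, if_neg h, if_neg h']
    -- membership facts
    have herase0 : ∀ S ∈ 𝒟, n ∈ S → S.erase n ∈ 𝒟₀ := by
      intro S hS hnS
      exact (h0mem _).2 ⟨hdown S hS _ (Finset.erase_subset n S), Finset.notMem_erase n S⟩
    have hmem1 : ∀ S ∈ 𝒟, n ∉ S → insert n S ∈ 𝒟 → S ∈ 𝒟₁ := by
      intro S hS hnS hSn; exact (h1mem S).2 ⟨⟨hS, hnS⟩, hSn⟩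
    have hmem0 : ∀ S ∈ 𝒟, n ∉ S → S ∈ 𝒟₀ := by
      intro S hS hnS; exact (h0mem S).2 ⟨hS, hnS⟩
    -- `n` is not in the images of `ψ₀`, `ψ₁` (they live in `U`)
    have hnψ₀ : ∀ T ∈ 𝒟₀, n ∉ ψ₀ T := fun T hT h => hn ((hψ₀ T hT).2.1 h)
    have hnψ₁ : ∀ T ∈ 𝒟₁, n ∉ ψ₁ T := fun T hT h => hn ((hψ₁ T hT).2.1 h)
    refine ⟨ψ, ?_, ?_⟩
    · -- injectivity on 𝒟
      intro S hS S' hS' hEq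
      have hS : S ∈ 𝒟 := hS
      have hS' : S' ∈ 𝒟 := hS'
      -- classify S and S'
      by_cases hnS : n ∈ S
      · rw [hψ_in S hnS] at hEq
        by_cases hnS' : n ∈ S'
        · rw [hψ_in S' hnS'] at hEq
          have h1 : ψ₀ (S.erase n) = ψ₀ (S'.erase n) := by
            have := congrArg (fun X => X.erase n) hEq
            rwa [Finset.erase_insert (hnψ₀ _ (herase0 S hS hnS)),
              Finset.erase_insert (hnψ₀ _ (herase0 S' hS' hnS'))] at this
          have h2 : S.erase n = S'.erase n := hinj₀ (herase0 S hS hnS) (herase0 S' hS' hnS') h1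
          rw [← Finset.insert_erase hnS, ← Finset.insert_erase hnS', h2]
        · by_cases hSn' : insert n S' ∈ 𝒟
          · rw [hψ_one S' hnS' hSn'] at hEq
            exact absurd (hEq ▸ Finset.mem_insert_self n _) (hnψ₁ _ (hmem1 S' hS' hnS' hSn'))
          · rw [hψ_zero S' hnS' hSn'] at hEq
            have h1 : ψ₀ (S.erase n) = ψ₀ S' := by
              have := congrArg (fun X => X.erase n) hEq
              rwa [Finset.erase_insert (hnψ₀ _ (herase0 S hS hnS)),
                Finset.erase_insert (hnψ₀ _ (hmem0 S' hS' hnS'))] at this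
            have h2 : S.erase n = S' := hinj₀ (herase0 S hS hnS) (hmem0 S' hS' hnS') h1
            exact absurd (by rw [← h2, Finset.insert_erase hnS]; exact hS) hSn'
      · by_cases hSn : insert n S ∈ 𝒟
        · rw [hψ_one S hnS hSn] at hEq
          by_cases hnS' : n ∈ S'
          · rw [hψ_in S' hnS'] at hEq
            exact absurd (hEq.symm ▸ Finset.mem_insert_self n _) (hnψ₁ _ (hmem1 S hS hnS hSn))
          · by_cases hSn' : insert n S' ∈ 𝒟
            · rw [hψ_one S' hnS' hSn'] at hEq
              exact hinj₁ (hmem1 S hS hnS hSn) (hmem1 S' hS' hnS' hSn') hEq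
            · rw [hψ_zero S' hnS' hSn'] at hEq
              exact absurd (hEq.symm ▸ Finset.mem_insert_self n _) (hnψ₁ _ (hmem1 S hS hnS hSn))
        · rw [hψ_zero S hnS hSn] at hEq
          by_cases hnS' : n ∈ S'
          · rw [hψ_in S' hnS'] at hEq
            have h1 : ψ₀ S = ψ₀ (S'.erase n) := by
              have := congrArg (fun X => X.erase n) hEq
              rwa [Finset.erase_insert (hnψ₀ _ (hmem0 S hS hnS)),
                Finset.erase_insert (hnψ₀ _ (herase0 S' hS' hnS'))] at this
            have h2 : S = S'.erase n := hinj₀ (hmem0 S hS hnS) (herase0 S' hS' hnS') h1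
            exact absurd (by rw [h2, Finset.insert_erase hnS']; exact hS') hSn
          · by_cases hSn' : insert n S' ∈ 𝒟
            · rw [hψ_one S' hnS' hSn'] at hEq
              exact absurd (hEq ▸ Finset.mem_insert_self n _) (hnψ₁ _ (hmem1 S' hS' hnS' hSn'))
            · rw [hψ_zero S' hnS' hSn'] at hEq
              have h1 : ψ₀ S = ψ₀ S' := by
                have := congrArg (fun X => X.erase n) hEq
                rwa [Finset.erase_insert (hnψ₀ _ (hmem0 S hS hnS)),
                  Finset.erase_insert (hnψ₀ _ (hmem0 S' hS' hnS'))] at this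
              exact hinj₀ (hmem0 S hS hnS) (hmem0 S' hS' hnS') h1
    · -- extensive, inside the universe, complement in 𝒟
      intro S hS
      by_cases hnS : n ∈ S
      · have hT := herase0 S hS hnS
        obtain ⟨hsub, hsubU, hcompl⟩ := hψ₀ _ hT
        rw [hψ_in S hnS]
        refine ⟨?_, Finset.insert_subset_insert n hsubU, ?_⟩
        · intro x hx
          by_cases hxn : x = n
          · rw [hxn]; exact Finset.mem_insert_self n _
          · exact Finset.mem_insert_of_mem (hsub (Finset.mem_erase.2 ⟨hxn, hx⟩))
        · have : insert n U \ insert n (ψ₀ (S.erase n)) = U \ ψ₀ (S.erase n) := by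
            ext x
            simp only [Finset.mem_sdiff, Finset.mem_insert]
            constructor
            · rintro ⟨h1, h2⟩
              rcases h1 with h | h
              · exact absurd (Or.inl h) h2
              · exact ⟨h, fun h' => h2 (Or.inr h')⟩
            · rintro ⟨h1, h2⟩
              exact ⟨Or.inr h1, fun h => h.elim (fun h' => hn (h' ▸ h1)) h2⟩
          rw [this]
          exact ((h0mem _).1 hcompl).1
      · by_cases hSn : insert n S ∈ 𝒟
        · have hT := hmem1 S hS hnS hSn
          obtain ⟨hsub, hsubU, hcompl⟩ := hψ₁ _ hT
          rw [hψ_one S hnS hSn]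
          refine ⟨hsub, hsubU.trans (Finset.subset_insert n U), ?_⟩
          have : insert n U \ ψ₁ S = insert n (U \ ψ₁ S) := by
            ext x
            simp only [Finset.mem_sdiff, Finset.mem_insert]
            constructor
            · rintro ⟨h1, h2⟩
              rcases h1 with h | h
              · exact Or.inl h
              · exact Or.inr ⟨h, h2⟩
            · rintro (h | ⟨h1, h2⟩)
              · exact ⟨Or.inl h, fun h' => hnψ₁ _ hT (h ▸ h')⟩
              · exact ⟨Or.inr h1, h2⟩
          rw [this]
          exact ((h1mem _).1 hcompl).2
        · have hT := hmem0 S hS hnS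
          obtain ⟨hsub, hsubU, hcompl⟩ := hψ₀ _ hT
          rw [hψ_zero S hnS hSn]
          refine ⟨hsub.trans (Finset.subset_insert n _), Finset.insert_subset_insert n hsubU, ?_⟩
          have : insert n U \ insert n (ψ₀ S) = U \ ψ₀ S := by
            ext x
            simp only [Finset.mem_sdiff, Finset.mem_insert]
            constructor
            · rintro ⟨h1, h2⟩
              rcases h1 with h | h
              · exact absurd (Or.inl h) h2
              · exact ⟨h, fun h' => h2 (Or.inr h')⟩
            · rintro ⟨h1, h2⟩
              exact ⟨Or.inr h1, fun h => h.elim (fun h' => hn (h' ▸ h1)) h2⟩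
          rw [this]
          exact ((h0mem _).1 hcompl).1

/-- **Down-set matching lemma** (whole type).  For a down-closed family `𝒟` of subsets of a finite type there is a map
`ψ`, injective on `𝒟`, with `S ⊆ ψ S` and `(ψ S)ᶜ ∈ 𝒟` for every `S ∈ 𝒟`; i.e. a perfect matching along inclusions
between `𝒟` and the up-set of complements `{Dᶜ : D ∈ 𝒟}`. [this work] -/
theorem exists_matching [Fintype α] (𝒟 : Finset (Finset α)) (hdown : ∀ S ∈ 𝒟, ∀ T, T ⊆ S → T ∈ 𝒟) :
    ∃ ψ : Finset α → Finset α, Set.InjOn ψ (𝒟 : Set (Finset α)) ∧ ∀ S ∈ 𝒟, S ⊆ ψ S ∧ (ψ S)ᶜ ∈ 𝒟 := by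
  obtain ⟨ψ, hinj, hψ⟩ := exists_matching_aux (Finset.univ : Finset α) 𝒟 (fun S _ => Finset.subset_univ S) hdown
  refine ⟨ψ, hinj, fun S hS => ⟨(hψ S hS).1, ?_⟩⟩
  have h := (hψ S hS).2.2
  rwa [← Finset.compl_eq_univ_sdiff] at h

/-- **Application: co-goods are matched to goods.**  If `𝔊` is an up-set of subsets of a finite type (the good points)
then there is a map `ψ`, injective on the co-goods `{b : bᶜ ∈ 𝔊}`, with `b ⊆ ψ b ∈ 𝔊` for every co-good `b`.
Consequently every set `A` with `(A \ C)ᶜ ∈ 𝔊` for some `C ⊆ ⋂ 𝔊` (a member whose reduced set is a co-good, memo §11)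
is carried to the good `ψ (A \ C) ⊇ A`. [this work] -/
theorem exists_cogood_transport [Fintype α] (𝔊 : Finset (Finset α))
    (hup : ∀ g ∈ 𝔊, ∀ g', g ⊆ g' → g' ∈ 𝔊) :
    ∃ ψ : Finset α → Finset α,
      Set.InjOn ψ ((Finset.univ.filter fun b : Finset α => bᶜ ∈ 𝔊 : Finset (Finset α)) : Set (Finset α)) ∧
        ∀ b : Finset α, bᶜ ∈ 𝔊 → b ⊆ ψ b ∧ ψ b ∈ 𝔊 := by
  classical
  set 𝒟 : Finset (Finset α) := Finset.univ.filter fun b : Finset α => bᶜ ∈ 𝔊 with h𝒟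
  have hmem : ∀ b, b ∈ 𝒟 ↔ bᶜ ∈ 𝔊 := by
    intro b; rw [h𝒟, Finset.mem_filter]; simp
  have hdown : ∀ S ∈ 𝒟, ∀ T, T ⊆ S → T ∈ 𝒟 := by
    intro S hS T hTS
    rw [hmem] at hS ⊢
    exact hup _ hS _ (Finset.compl_subset_compl.2 hTS)
  obtain ⟨ψ, hinj, hψ⟩ := exists_matching 𝒟 hdown
  refine ⟨ψ, hinj, fun b hb => ?_⟩
  obtain ⟨hsub, hcompl⟩ := hψ b ((hmem b).2 hb)
  refine ⟨hsub, ?_⟩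
  have := (hmem _).1 hcompl
  rwa [compl_compl] at this

end DownsetMatching

end Summit.CriticalPhenomena.PercolationContinuityZ3.Theorems
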